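import Literature.NumberTheory.GaloisRepresentations.GlobalReciprocityModPowersLayers
import Literature.NumberTheory.GaloisRepresentations.IdeleClassCharacterPairingEmbedded
import Literature.NumberTheory.NumberFields.ArtinMapDecompositionInertia
import Literature.NumberTheory.QuadraticForms.QuadraticNormIndex
import Literature.NumberTheory.Automorphic.UnitIdeleArchimedeanIntegration
import HarnessLib

/-!
# `x̄ ∈ C_Kᵐ · Ū_K^S ⟺ χ(ψ_{L|K} x) = 0` for every `ℤ/m`-character `χ` of every finite abelian layer `L ⊆ K̄`
# UNRAMIFIED OUTSIDE `S` (Harari Prop. 15.42 (a) / Lang XI §4 Thm. 4; Milne ADT I Thm. 1.8 (b) for `(G_S, C_S)`)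

Topic `NumberTheory/GaloisRepresentations`; namespace `Literature.NumberTheory.GaloisRepresentations`.  Theorems only (no
definition, no named fact, no instance, no notation, no `sorry`); number fields in `Type`.

door-c6 g13/g14 recorded the injectivity of Milne's `α¹(Γ_K, ℤ/m)` for the idèle class formation `(Γ_K, C̄)` on the
finite layers (`mem_range_pow_iff_forall_layer_character`: `x̄ ∈ C_Kᵐ ⟺ χ(ψ_{L|K} x) = 0` for all finite abelian
`L ⊆ K̄` and all `χ : Gal(L/K) → ℤ/m`).  For the `P`-class formation `(G_S, C_S)` of a Galois group with restricted
ramification (Harari Thm. 17.2, `C_S = lim→ C_L / U_{L,S}`) the same hypothesis of Tate's duality theorem reads, at the base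
layer: **`x̄ ∈ C_Kᵐ · Ū_K^S ⟺ χ(ψ_{L|K} x) = 0` for every finite abelian `L ⊆ K̄` UNRAMIFIED OUTSIDE `S` and every
`χ : Gal(L/K) → ℤ/m`**, where `U_K^S = unitIdelesOutside K S` (idèles `1` at `S` and at infinity, local units elsewhere;
Neukirch's `U_K^S`, Harari's `U_{k,S}` up to the archimedean components) and `Ū_K^S` is its image in `C_K`.  This is
Harari's Prop. 15.42 (a) — `0 → D_S(k) → C_S(k) → G_S^{ab} → 0` with `D_S(k)` divisible — read modulo `m`, i.e.
`C_S(K)/m ≅ G_{K,S}^{ab}/m`, injectivity; equivalently Lang's ramification theorem XI §4 Thm. 4 («`v` is unramified in the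
class field to `H` iff `U_v ⊂ H`») applied to the class field of `C_Kᵐ Ū_K^S`.

* §1 `isClosed_unitIdelesOutside`, `isCompact_unitIdelesOutside` — `U_K^S` is a compact subgroup of `𝕀_K` (closed in the
  compact `{x ∈ 𝕌_K : ‖x_w‖ ≤ 1, ‖x⁻¹_w‖ ≤ 1}` of the tree).
* §2 `localUnits_mem_unitIdelesOutside` (`⟨𝒪_vˣ⟩_v ≤ U_K^S` for `v ∉ S`) and the decomposition
  `exists_prod_localUnits_mul_of_mem_unitIdelesOutside`: `u ∈ U_K^S` is `∏_{v ∈ D ∖ S} ⟨u_v⟩_v · u'` with `u' ∈ U_K^{S ∪ D}`.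
* §3 **`artinIdeleMap_eq_one_of_mem_unitIdelesOutside`**: `ψ_{L|K}(U_K^S) = 1` for `L` unramified outside `S` (open kernel
  `⊇ U_K^{S'}` + Lang XI §4 Thm. 4 at the finitely many `v ∈ S' ∖ S`: `isUnramifiedIn_iff_forall_artinIdeleMap_localUnits_eq_one`).
* §4 **`character_artinIdeleMap_eq_zero_of_mem_pow_sup_unitIdelesOutside`** (the easy half) and
  **`exists_unramified_layer_character_ne_zero_of_not_mem_pow_sup_unitIdelesOutside`** (the hard half): if
  `x̄ ∉ C_Kᵐ Ū_K^S` then `θ x̄ ∉ W := (Γ_K^{ab})ᵐ · θ(Ū_K^S)` (`θ⁻¹((Γ^{ab})ᵐ) = C_Kᵐ`, door-c6 g11), a CLOSED subgroup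
  (closed times compact) of the profinite abelian `Γ_K^{ab}`, so a continuous `χ₀ : Γ_K^{ab} → ℚ/ℤ` kills `W` but not `θ x̄`
  (Pontryagin); `χ₀ ∘ θ` has open kernel of finite index, hence (existence theorem in kernel form, `exists_ker_artinMapFamily_le`)
  factors through `Gal(L/K)` for a finite abelian `L`; replacing `L` by the fixed field of the kernel of the descended
  character makes the layer unramified outside `S` (`ψ_{L|K}(⟨𝒪_vˣ⟩_v) ⊆ ker` for `v ∉ S` since `χ₀` kills `θ(Ū_K^S)`;
  `artinIdeleMap_lift_fixedField_eq_one_iff`, Lang XI §4 Thm. 4), and the character survives with values in `ℤ/m`.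
* §5 **`mk_mem_pow_sup_unitIdelesOutside_iff_forall_unramified_character`** (the equivalence) and its Bockstein form
  **`forall_unramified_layer_pairing_eq_zero_iff_mk_mem_pow_sup_unitIdelesOutside`**:
  `inv_{L/K}(ι[x] ∪ β_m[χ]) = 0` for all such `L, χ` iff `x̄ ∈ C_Kᵐ Ū_K^S` (door-c6 g14's dictionary
  `classInvAll_baseCup_bockstein_eq_zero_iff_artinIdeleMap`).

HONEST FRAMING: classical global class field theory (existence theorem, ramification theorem) + Pontryagin duality in the
tree's currency; no case of BSD / Poitou–Tate is proved.  Written for the background lane «PT-Ш-S-TC» of cell bsd-eis (crux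
`GoodLatticeBDPValue`, stmt-BirchSwinnertonDyer-19032): it is the arithmetic core of the injectivity half of the field
`adjointBijective_one_zmod_pow` (`α¹(U, ℤ/pᵃ)` bijective) of `DiscreteRep.TateDualityHypothesesAt p` for the `S`-idèle class
formation `(G_S, C̄_S)`, to be consumed through door-c4 g16's `DiscreteRep.adjointInjective_triv_zmod_of_cofinal`.

## References
* D. Harari, *Galois Cohomology and Class Field Theory*, Universitext (2020), Prop. 15.42 (a), Thm. 17.2. [Harari2020]
* S. Lang, *Algebraic Number Theory*, 2nd ed., GTM 110 (1994), Ch. XI §4 Theorem 4. [LangANT1994]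
* J. Neukirch, *Class Field Theory — The Bonn Lectures* (2013), Part III §7 (p. 175: `U_K^S`), Thm. (7.8), (7.12). [Neukirch2013]
* J. S. Milne, *Arithmetic Duality Theorems*, 2nd ed. (2006), Ch. I Thm. 1.8 (b), §4 (the class formation `(G_S, C_S)`).
  [MilneADT2006]
* J.-P. Serre, *Local Fields*, GTM 67 (1979), XIII §1 (characters of profinite abelian groups). [SerreLocalFields1979]
-/

noncomputable section

open scoped NumberField
open NumberField IsDedekindDomain Field Function Topology

namespace Literature.NumberTheory.GaloisRepresentations

open _root_.TopRep _root_.ContRepresentation _root_.ContinuousCohomology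
open Literature.AnabelianGeometry.AbsoluteAnabelian.Prop121vii
open Literature.NumberTheory.QuadraticForms (ideleFiniteComponent val_ideleFiniteComponent)
open Literature.NumberTheory.NumberFields

variable {K : Type} [Field K] [NumberField K]

/-! ## §1. `U_K^S` is a compact subgroup of `𝕀_K` -/

/-- The infinite part of the inverse of an idèle with trivial infinite part is trivial. [folklore] -/
private theorem ideleGroup_val_inv_fst_eq_one {x : ideleGroup K} (hx : (x : AdeleRing (𝓞 K) K).1 = 1) :
    ((x⁻¹ : ideleGroup K) : AdeleRing (𝓞 K) K).1 = 1 := by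
  have h := ideleGroup_val_inv_fst_mul x
  rwa [hx, mul_one] at h

variable (K) in
/-- **`U_K^S` is closed in `𝕀_K`**: it is cut out of the open (hence closed) subgroup `𝕌_K` of unit idèles by the closed
conditions `x_∞ = 1` and `x_v = 1` (`v ∈ S`). [cite: Neukirch2013, Part III §7, p. 175] -/
theorem isClosed_unitIdelesOutside (S : Finset (HeightOneSpectrum (𝓞 K))) :
    IsClosed ((unitIdelesOutside K S : Subgroup (ideleGroup K)) : Set (ideleGroup K)) := by
  haveI : T2Space (InfiniteAdeleRing K) := inferInstanceAs (T2Space ((v : InfinitePlace K) → v.Completion))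
  have h1 : IsClosed {x : ideleGroup K | (x : AdeleRing (𝓞 K) K).1 = 1} :=
    isClosed_eq (continuous_fst.comp Units.continuous_val) continuous_const
  have h2 : IsClosed (⋂ v ∈ S, {x : ideleGroup K | (x : AdeleRing (𝓞 K) K).2 v = 1}) :=
    isClosed_biInter fun v _ =>
      isClosed_eq ((RestrictedProduct.continuous_eval v).comp (continuous_snd.comp Units.continuous_val))
        continuous_const
  have h3 : IsClosed ((unitIdeles K : Subgroup (ideleGroup K)) : Set (ideleGroup K)) :=
    (unitIdeles K).isClosed_of_isOpen (isOpen_unitIdeles K)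
  have heq : ((unitIdelesOutside K S : Subgroup (ideleGroup K)) : Set (ideleGroup K)) =
      {x : ideleGroup K | (x : AdeleRing (𝓞 K) K).1 = 1} ∩
        (⋂ v ∈ S, {x : ideleGroup K | (x : AdeleRing (𝓞 K) K).2 v = 1}) ∩
          ((unitIdeles K : Subgroup (ideleGroup K)) : Set (ideleGroup K)) := by
    ext x
    simp only [SetLike.mem_coe, mem_unitIdelesOutside_iff, Set.mem_inter_iff, Set.mem_setOf_eq, Set.mem_iInter,
      mem_unitIdeles_iff]
    exact ⟨fun ⟨a, b, c⟩ => ⟨⟨a, b⟩, c⟩, fun ⟨⟨a, b⟩, c⟩ => ⟨a, b, c⟩⟩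
  rw [heq]
  exact (h1.inter h2).inter h3

variable (K) in
/-- **`U_K^S` is compact**: a closed subset of the compact `{x ∈ 𝕌_K : ‖x_w‖ ≤ 1, ‖x⁻¹_w‖ ≤ 1 for all w ∣ ∞}`
(`Automorphic.isCompact_setOf_mem_unitIdeles_norm_le`; `U_K^S ≅ ∏_{v ∉ S} 𝒪_vˣ`, a product of compact groups).
[cite: Neukirch2013, Part III §7, p. 175] [cite: Harari2020, Def. 15.38] -/
theorem isCompact_unitIdelesOutside (S : Finset (HeightOneSpectrum (𝓞 K))) :
    IsCompact ((unitIdelesOutside K S : Subgroup (ideleGroup K)) : Set (ideleGroup K)) := by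
  refine (Automorphic.isCompact_setOf_mem_unitIdeles_norm_le (K := K) 1 1).of_isClosed_subset
    (isClosed_unitIdelesOutside K S) fun x hx => ?_
  refine ⟨unitIdelesOutside_le_unitIdeles S hx, fun w => ⟨?_, ?_⟩⟩
  · rw [hx.1]
    change ‖(1 : w.Completion)‖ ≤ 1
    rw [norm_one]
  · rw [ideleGroup_val_inv_fst_eq_one hx.1]
    change ‖(1 : w.Completion)‖ ≤ 1
    rw [norm_one]

/-! ## §2. Local units off `S` lie in `U_K^S`; decomposition of `U_K^S` along a finite set of places -/

/-- **`⟨u⟩_v ∈ U_K^S` for a local unit `u ∈ 𝒪_vˣ` at a place `v ∉ S`.** [cite: Neukirch2013, Part III §7, p. 175] -/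
theorem localUnits_mem_unitIdelesOutside {S : Finset (HeightOneSpectrum (𝓞 K))} {v : HeightOneSpectrum (𝓞 K)}
    (hv : v ∉ S) (u : (v.adicCompletion K)ˣ) (hu : Valued.v (u : v.adicCompletion K) = 1) :
    localUnits v u ∈ unitIdelesOutside K S := by
  refine ⟨localUnits_fst v u, fun v' hv' => ?_, fun v' => ?_⟩
  · have hne : v' ≠ v := fun h => hv (h ▸ hv')
    exact localUnits_snd_apply_of_ne u hne
  · by_cases h : v' = v
    · subst h
      rw [localUnits_snd_apply_self]
      exact hu
    · rw [localUnits_snd_apply_of_ne u h, map_one]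

/-- The `v`-component of `u ∈ U_K^S`, as a unit, has valuation `1`. [folklore] -/
private theorem valued_ideleFiniteComponent_of_mem_unitIdelesOutside {S : Finset (HeightOneSpectrum (𝓞 K))}
    {u : ideleGroup K} (hu : u ∈ unitIdelesOutside K S) (v : HeightOneSpectrum (𝓞 K)) :
    Valued.v ((ideleFiniteComponent K v u : (v.adicCompletion K)ˣ) : v.adicCompletion K) = 1 := by
  rw [val_ideleFiniteComponent]
  exact hu.2.2 v

open scoped Classical in
/-- **Decomposition of `U_K^S` along a finite set of places**: for `u ∈ U_K^S` and a finite set `D` of finite places,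
`u = (∏_{v ∈ D ∖ S} ⟨u_v⟩_v) · u'` with `u' ∈ U_K^{S ∪ D}` (componentwise bookkeeping in `𝕀_K`).
[cite: Neukirch2013, Part III §7, p. 175] -/
theorem exists_prod_localUnits_mul_of_mem_unitIdelesOutside {S : Finset (HeightOneSpectrum (𝓞 K))}
    {u : ideleGroup K} (hu : u ∈ unitIdelesOutside K S) (D : Finset (HeightOneSpectrum (𝓞 K))) :
    ∃ u' ∈ unitIdelesOutside K (S ∪ D),
      u = (∏ v ∈ D \ S, localUnits v (ideleFiniteComponent K v u)) * u' := by
  set p : ideleGroup K := ∏ v ∈ D \ S, localUnits v (ideleFiniteComponent K v u) with hp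
  refine ⟨p⁻¹ * u, ?_, by rw [mul_inv_cancel_left]⟩
  have hp1 : (p : AdeleRing (𝓞 K) K).1 = 1 := by
    rw [hp]; exact fst_prod_localUnits _ _
  have hp2 : ∀ v, (p : AdeleRing (𝓞 K) K).2 v =
      if v ∈ D \ S then (u : AdeleRing (𝓞 K) K).2 v else 1 := fun v => by
    rw [hp, snd_prod_localUnits]
    split_ifs with h
    · rw [val_ideleFiniteComponent]
    · rfl
  have hne : ∀ v, (u : AdeleRing (𝓞 K) K).2 v ≠ 0 := fun v h0 => by
    have h1 := hu.2.2 v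
    rw [h0, map_zero] at h1
    exact zero_ne_one h1
  refine ⟨?_, fun v hv => ?_, fun v => ?_⟩
  · rw [ideleGroup_val_fst_mul, ideleGroup_val_inv_fst_eq_one hp1, hu.1, mul_one]
  · rw [ideleGroup_val_snd_mul, ideleGroup_val_inv_snd, hp2]
    rcases Finset.mem_union.mp hv with hvS | hvD
    · rw [if_neg (fun h => (Finset.mem_sdiff.mp h).2 hvS), inv_one, one_mul, hu.2.1 v hvS]
    · by_cases hvS : v ∈ S
      · rw [if_neg (fun h => (Finset.mem_sdiff.mp h).2 hvS), inv_one, one_mul, hu.2.1 v hvS]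
      · rw [if_pos (Finset.mem_sdiff.mpr ⟨hvD, hvS⟩), inv_mul_cancel₀ (hne v)]
  · rw [ideleGroup_val_snd_mul, ideleGroup_val_inv_snd, hp2, map_mul, map_inv₀]
    split_ifs with h
    · rw [hu.2.2 v, inv_one, one_mul]
    · rw [map_one, inv_one, one_mul, hu.2.2 v]

/-! ## §3. The Artin map of a layer unramified outside `S` kills `U_K^S` -/

/-- **`ψ_{L|K}(U_K^S) = 1` for `L ⊆ K̄` finite abelian unramified outside `S`** (Lang XI §4 Thm. 4 «`v` unramified in
the class field to `H` iff `U_v ⊂ H`», at the finitely many places `v ∉ S` where `ker ψ_{L|K} ⊇ U_K^{S'}` does not already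
decide): `u = ∏_{v ∈ S' ∖ S} ⟨u_v⟩_v · u'`, `u' ∈ U_K^{S ∪ S'} ⊆ ker ψ_{L|K}` (open kernel) and `ψ_{L|K}(⟨u_v⟩_v) = 1` for
`v ∉ S` (`isUnramifiedIn_iff_forall_artinIdeleMap_localUnits_eq_one`).
[cite: LangANT1994, Ch. XI §4 Thm. 4] [cite: Harari2020, Prop. 15.42 (a) (proof)] -/
theorem artinIdeleMap_eq_one_of_mem_unitIdelesOutside (L : IntermediateField K (AlgebraicClosure K))
    [FiniteDimensional K L] [NumberField L] [IsAbelianGalois K L] {S : Finset (HeightOneSpectrum (𝓞 K))}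
    (hL : ∀ v : HeightOneSpectrum (𝓞 K), v ∉ S → Algebra.IsUnramifiedIn (𝓞 L) v.asIdeal)
    {u : ideleGroup K} (hu : u ∈ unitIdelesOutside K S) :
    artinIdeleMap L artinReciprocity_character_holds u = 1 := by
  classical
  -- the kernel of `ψ_{L|K}` is open, hence contains some `U_K^{S'}`
  have hmem : ((artinIdeleMap L artinReciprocity_character_holds).ker : Set (ideleGroup K)) ∈ 𝓝 (1 : ideleGroup K) :=
    (isOpen_ker_artinIdeleMap L artinReciprocity_character_holds).mem_nhds (Subgroup.one_mem _)
  obtain ⟨S', hS'⟩ := exists_unitIdelesOutside_subset K hmem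
  obtain ⟨u', hu', hdec⟩ := exists_prod_localUnits_mul_of_mem_unitIdelesOutside hu S'
  have hu'ker : artinIdeleMap L artinReciprocity_character_holds u' = 1 := by
    have h : u' ∈ (artinIdeleMap L artinReciprocity_character_holds).ker :=
      hS' (unitIdelesOutside_antitone Finset.subset_union_right hu')
    exact h
  have hprod : (∏ v ∈ S' \ S, localUnits v (ideleFiniteComponent K v u)) ∈
      (artinIdeleMap L artinReciprocity_character_holds).ker := by
    refine Subgroup.prod_mem _ fun v hv => ?_
    have hvS : v ∉ S := (Finset.mem_sdiff.mp hv).2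
    rw [MonoidHom.mem_ker]
    exact (isUnramifiedIn_iff_forall_artinIdeleMap_localUnits_eq_one L).mp (hL v hvS) _
      (valued_ideleFiniteComponent_of_mem_unitIdelesOutside hu v)
  rw [MonoidHom.mem_ker] at hprod
  rw [hdec, map_mul, hu'ker, mul_one, hprod]

/-! ## §4. The two halves -/

/-- **The easy half: if `x̄ ∈ C_Kᵐ · Ū_K^S` then `χ(ψ_{L|K} x) = 0`** for every finite abelian `L ⊆ K̄` unramified
outside `S` and every `χ : Gal(L/K) → ℤ/m` (`ψ_{L|K}` kills `Kˣ` and `U_K^S`, and `χ` kills `m`-th powers).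
[cite: Harari2020, Prop. 15.42 (a)] [cite: MilneADT2006, Ch. I Thm. 1.8 (b)] -/
theorem character_artinIdeleMap_eq_zero_of_mem_pow_sup_unitIdelesOutside
    (L : IntermediateField K (AlgebraicClosure K)) [FiniteDimensional K L] [NumberField L] [IsAbelianGalois K L]
    {S : Finset (HeightOneSpectrum (𝓞 K))}
    (hL : ∀ v : HeightOneSpectrum (𝓞 K), v ∉ S → Algebra.IsUnramifiedIn (𝓞 L) v.asIdeal) {m : ℕ} {x : ideleGroup K}
    (hx : (QuotientGroup.mk x : ideleGroup K ⧸ principalIdeles K) ∈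
      (@powMonoidHom (ideleGroup K ⧸ principalIdeles K) _ m).range ⊔
        (unitIdelesOutside K S).map (QuotientGroup.mk' (principalIdeles K)))
    (χ : Additive (L ≃ₐ[K] L) →+ ZMod m) :
    χ (Additive.ofMul (artinIdeleMap L artinReciprocity_character_holds x)) = 0 := by
  obtain ⟨y, hy, z, hz, hyz⟩ := Subgroup.mem_sup.mp hx
  obtain ⟨c, rfl⟩ := hy
  obtain ⟨u, hu, rfl⟩ := Subgroup.mem_map.mp hz
  have h : artinIdeleMap L artinReciprocity_character_holds x = artinClassMap L artinReciprocity_character_holds c ^ m := by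
    rw [← artinClassMap_mk L artinReciprocity_character_holds x, ← hyz, map_mul, QuotientGroup.mk'_apply,
      artinClassMap_mk, artinIdeleMap_eq_one_of_mem_unitIdelesOutside L hL hu, mul_one, powMonoidHom_apply, map_pow]
  rw [h, ofMul_pow, map_nsmul, nsmul_eq_mul, ZMod.natCast_self, zero_mul]

omit [NumberField K] in
/-- `L^H ⊆ K̄` is finite over `K` (auxiliary; `H ≤ Gal(L/K)`). [folklore] -/
private theorem finiteDimensional_lift_fixedField' (L : IntermediateField K (AlgebraicClosure K)) [FiniteDimensional K L]
    (H : Subgroup (L ≃ₐ[K] L)) :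
    FiniteDimensional K (IntermediateField.lift (IntermediateField.fixedField H) :
      IntermediateField K (AlgebraicClosure K)) :=
  LinearEquiv.finiteDimensional (IntermediateField.liftAlgEquiv (IntermediateField.fixedField H)).toLinearEquiv

omit [NumberField K] in
/-- `L^H ⊆ K̄` is abelian over `K` when `L` is (auxiliary). [folklore] -/
private theorem isAbelianGalois_lift_fixedField' (L : IntermediateField K (AlgebraicClosure K)) [IsAbelianGalois K L]
    (H : Subgroup (L ≃ₐ[K] L)) :
    IsAbelianGalois K (IntermediateField.lift (IntermediateField.fixedField H) :
      IntermediateField K (AlgebraicClosure K)) :=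
  IsAbelianGalois.of_algHom (IntermediateField.inclusion (IntermediateField.lift_le _))

/-- **The hard half: if `x̄ ∉ C_Kᵐ · Ū_K^S` (`m ≥ 1`), some `ℤ/m`-character `χ` of some finite abelian `L ⊆ K̄` UNRAMIFIED
OUTSIDE `S` has `χ(ψ_{L|K} x) ≠ 0`.**  With THE reciprocity map `θ : C_K → Γ_K^{ab}` (door-c6 g11–g13):
`θ x̄ ∉ W := θ(Ū_K^S) · (Γ_K^{ab})ᵐ` (because `θ⁻¹((Γ^{ab})ᵐ) = C_Kᵐ`), a closed subgroup (compact times closed) of the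
profinite abelian `Γ_K^{ab}`; a continuous `χ₀ : Γ_K^{ab} → ℚ/ℤ` kills `W` but not `θ x̄`; `χ₀ ∘ θ` has open kernel of finite
index, so by the existence theorem it factors through `Gal(L/K)`, `L` finite abelian; the fixed field `L'` of the kernel of
the descended character is unramified outside `S` (Lang XI §4 Thm. 4: `ψ_{L|K}(⟨𝒪_vˣ⟩_v)` lies in that kernel for `v ∉ S`,
as `χ₀` kills `θ(Ū_K^S)`), and the character of `Gal(L'/K)` so obtained takes values in `(1/m)ℤ/ℤ ≅ ℤ/m`.
[cite: Harari2020, Prop. 15.42 (a)] [cite: LangANT1994, Ch. XI §4 Thm. 4] [cite: Neukirch2013, Part III Thm. (7.8), (7.12)]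
[cite: SerreLocalFields1979, XIII §1] -/
theorem exists_unramified_layer_character_ne_zero_of_not_mem_pow_sup_unitIdelesOutside {m : ℕ} (hm : 0 < m)
    (S : Finset (HeightOneSpectrum (𝓞 K))) {x : ideleGroup K}
    (hx : (QuotientGroup.mk x : ideleGroup K ⧸ principalIdeles K) ∉
      (@powMonoidHom (ideleGroup K ⧸ principalIdeles K) _ m).range ⊔
        (unitIdelesOutside K S).map (QuotientGroup.mk' (principalIdeles K))) :
    ∃ (L : IntermediateField K (AlgebraicClosure K)) (_ : FiniteDimensional K L) (_ : IsAbelianGalois K L),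
      (∀ v : HeightOneSpectrum (𝓞 K), v ∉ S →
        Algebra.IsUnramifiedIn (𝓞 (L : IntermediateField K (AlgebraicClosure K))) v.asIdeal) ∧
      ∃ χ : Additive (L ≃ₐ[K] L) →+ ZMod m,
        haveI : NumberField L := NumberField.of_module_finite K L
        χ (Additive.ofMul (artinIdeleMap L artinReciprocity_character_holds x)) ≠ 0 := by
  classical
  haveI : NeZero m := ⟨hm.ne'⟩
  set θ := (isCompatibleSystem_artinMapFamily (K := K) artinReciprocity_character_holds).theta with hθdef
  have hθ : IsGlobalReciprocityMap K θ := isGlobalReciprocityMap_artinTheta K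
  haveI : TotallyDisconnectedSpace (absoluteGaloisGroupAbelianization K) :=
    IsGlobalReciprocityMap.totallyDisconnectedSpace_abelianization K
  haveI : CompactSpace (absoluteGaloisGroup K) := absoluteGaloisGroup_compactSpace K
  -- the closed subgroup `W = θ(Ū_K^S) · (Γ^{ab})ᵐ`
  set φ : ideleGroup K →* absoluteGaloisGroupAbelianization K := θ.comp (QuotientGroup.mk' (principalIdeles K)) with hφ
  set W : Subgroup (absoluteGaloisGroupAbelianization K) :=
    (unitIdelesOutside K S).map φ ⊔ (@powMonoidHom (absoluteGaloisGroupAbelianization K) _ m).range with hW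
  have hφcont : Continuous φ := hθ.continuous.comp (QuotientGroup.continuous_mk (N := principalIdeles K))
  have hWclosed : IsClosed (W : Set (absoluteGaloisGroupAbelianization K)) := by
    rw [hW, Subgroup.mul_normal, Subgroup.coe_map]
    exact (IsGlobalReciprocityMap.isClosed_range_powMonoidHom_abelianization K m).mul_left_of_isCompact
      ((isCompact_unitIdelesOutside K S).image hφcont)
  -- `θ x̄ ∉ W`
  have hxW : θ (QuotientGroup.mk x) ∉ W := by
    intro h
    obtain ⟨a, ha, b, hb, hab⟩ := Subgroup.mem_sup.mp h
    obtain ⟨u, hu, rfl⟩ := Subgroup.mem_map.mp ha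
    have hdiv : θ (QuotientGroup.mk x / QuotientGroup.mk' (principalIdeles K) u) ∈
        (@powMonoidHom (absoluteGaloisGroupAbelianization K) _ m).range := by
      rw [map_div, ← hab, hφ, MonoidHom.comp_apply, mul_div_cancel_left]
      exact hb
    have hdiv' := (hθ.map_mem_range_powMonoidHom_iff hm _).1 hdiv
    refine hx (Subgroup.mem_sup.mpr ⟨_, hdiv', QuotientGroup.mk' (principalIdeles K) u,
      Subgroup.mem_map_of_mem _ hu, div_mul_cancel _ _⟩)
  obtain ⟨χ₀, hχ₀W, hχ₀x⟩ := exists_character_trivialOn_apply_ne_zero W hWclosed hxW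
  have hχ₀m : ∀ g : absoluteGaloisGroupAbelianization K, χ₀.1 (g ^ m) = 0 := fun g =>
    hχ₀W _ (Subgroup.mem_sup_right ⟨g, rfl⟩)
  have hχ₀U : ∀ u ∈ unitIdelesOutside K S, χ₀.1 (θ (QuotientGroup.mk u)) = 0 := fun u hu =>
    hχ₀W _ (Subgroup.mem_sup_left (Subgroup.mem_map_of_mem φ hu))
  -- `f = χ₀ ∘ θ : C_K → ℚ/ℤ` as a monoid homomorphism into `Multiplicative`
  let f : (ideleGroup K ⧸ principalIdeles K) →* Multiplicative QModZCoeff.{0} :=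
    (contOneCocycles.toMonoidHomOfTrivial χ₀).comp θ
  have hf : ∀ c, f c = Multiplicative.ofAdd (χ₀.1 (θ c)) := fun c => rfl
  -- its kernel is open …
  have hcont : Continuous f := (continuous_ofAdd.comp χ₀.1.continuous).comp hθ.continuous
  have hopen : IsOpen (f.ker : Set (ideleGroup K ⧸ principalIdeles K)) := by
    have : (f.ker : Set (ideleGroup K ⧸ principalIdeles K)) = f ⁻¹' {1} := by
      ext c; simp [MonoidHom.mem_ker]
    rw [this]
    exact (isOpen_discrete ({1} : Set (Multiplicative QModZCoeff.{0}))).preimage hcont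
  -- … and of finite index: the values of `f` are `m`-torsion, a finite set
  have hval : ∀ c, ∃ k : ZMod m, zmodToQmodZ m k = (χ₀.1 (θ c)).down := fun c => by
    refine exists_zmodToQmodZ_eq_of_nsmul_eq_zero m ?_
    have h1 : m • χ₀.1 (θ c) = 0 := by
      have h2 := congrArg Multiplicative.toAdd (map_pow (contOneCocycles.toMonoidHomOfTrivial χ₀) (θ c) m)
      rw [contOneCocycles.toMonoidHomOfTrivial_apply, contOneCocycles.toMonoidHomOfTrivial_apply, toAdd_ofAdd,
        toAdd_pow, toAdd_ofAdd, hχ₀m (θ c)] at h2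
      exact h2.symm
    exact congrArg ULift.down h1
  have hfin : (Set.range f).Finite := by
    refine (Set.finite_range fun k : ZMod m =>
      Multiplicative.ofAdd (ULift.up.{0} (zmodToQmodZ m k) : QModZCoeff.{0})).subset ?_
    rintro _ ⟨c, rfl⟩
    obtain ⟨k, hk⟩ := hval c
    refine ⟨k, ?_⟩
    show Multiplicative.ofAdd (ULift.up.{0} (zmodToQmodZ m k) : QModZCoeff.{0}) = f c
    rw [hk, ULift.up_down, hf c]
    rfl
  haveI : Finite f.range := hfin.to_subtype
  haveI : Finite ((ideleGroup K ⧸ principalIdeles K) ⧸ f.ker) :=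
    Finite.of_equiv f.range (QuotientGroup.quotientKerEquivRange f).symm.toEquiv
  have hfi : f.ker.FiniteIndex := Subgroup.finiteIndex_of_finite_quotient
  -- existence theorem, kernel form: `ker ψ̄_L ≤ ker f` for a finite abelian `L`
  obtain ⟨L, hLfd, hLab, hker⟩ := exists_ker_artinMapFamily_le f.ker hopen hfi
  haveI := hLfd
  haveI := hLab
  haveI : NumberField L := NumberField.of_module_finite K L
  -- descend `f` to `Gal(L/K)`
  have hsurj : Surjective (artinMapFamily K artinReciprocity_character_holds L) :=
    artinMapFamily_surjective artinReciprocity_character_holds L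
  let g : (L ≃ₐ[K] L) →* Multiplicative QModZCoeff.{0} :=
    (artinMapFamily K artinReciprocity_character_holds L).liftOfSurjective hsurj ⟨f, hker⟩
  have hg : ∀ c, g (artinMapFamily K artinReciprocity_character_holds L c) = f c := fun c =>
    (artinMapFamily K artinReciprocity_character_holds L).liftOfRightInverse_comp_apply _ _ ⟨f, hker⟩ c
  have hgψ : ∀ y : ideleGroup K, g (artinIdeleMap L artinReciprocity_character_holds y) = f (QuotientGroup.mk y) :=
    fun y => by rw [← artinClassMap_mk L artinReciprocity_character_holds y,
      ← artinMapFamily_eq artinReciprocity_character_holds L, hg]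
  -- the layer: the fixed field `L'` of `ker g`
  set H : Subgroup (L ≃ₐ[K] L) := g.ker with hH
  set L' : IntermediateField K (AlgebraicClosure K) := IntermediateField.lift (IntermediateField.fixedField H) with hL'
  haveI hL'fd : FiniteDimensional K L' := finiteDimensional_lift_fixedField' L H
  haveI hL'ab : IsAbelianGalois K L' := isAbelianGalois_lift_fixedField' L H
  haveI : NumberField L' := NumberField.of_module_finite K L'
  -- `ψ_{L'|K}(y) = 1 ⟺ ψ_{L|K}(y) ∈ H ⟺ f ȳ = 1`
  have hL'ker : ∀ y : ideleGroup K,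
      artinIdeleMap L' artinReciprocity_character_holds y = 1 ↔ f (QuotientGroup.mk y) = 1 := by
    intro y
    refine (artinIdeleMap_lift_fixedField_eq_one_iff L H y).trans ?_
    rw [hH, MonoidHom.mem_ker, hgψ]
  -- `L'` is unramified outside `S`
  have hL'unr : ∀ v : HeightOneSpectrum (𝓞 K), v ∉ S → Algebra.IsUnramifiedIn (𝓞 L') v.asIdeal := by
    intro v hv
    refine (isUnramifiedIn_iff_forall_artinIdeleMap_localUnits_eq_one L').mpr fun u hu => ?_
    rw [hL'ker, hf]
    change Multiplicative.ofAdd (χ₀.1 (θ (QuotientGroup.mk (localUnits v u)))) = Multiplicative.ofAdd 0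
    rw [hχ₀U _ (localUnits_mem_unitIdelesOutside hv u hu)]
  -- descend `f` to `Gal(L'/K)`
  have hsurj' : Surjective (artinMapFamily K artinReciprocity_character_holds L') :=
    artinMapFamily_surjective artinReciprocity_character_holds L'
  have hker' : (artinMapFamily K artinReciprocity_character_holds L').ker ≤ f.ker := by
    intro c hc
    induction c using QuotientGroup.induction_on with
    | H y =>
      rw [MonoidHom.mem_ker, artinMapFamily_eq artinReciprocity_character_holds L', artinClassMap_mk] at hc
      rw [MonoidHom.mem_ker]
      exact (hL'ker y).mp hc
  let g' : (L' ≃ₐ[K] L') →* Multiplicative QModZCoeff.{0} :=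
    (artinMapFamily K artinReciprocity_character_holds L').liftOfSurjective hsurj' ⟨f, hker'⟩
  have hg' : ∀ c, g' (artinMapFamily K artinReciprocity_character_holds L' c) = f c := fun c =>
    (artinMapFamily K artinReciprocity_character_holds L').liftOfRightInverse_comp_apply _ _ ⟨f, hker'⟩ c
  -- the values of `g'` in `ℤ/m`
  have hgval : ∀ σ : L' ≃ₐ[K] L', ∃ k : ZMod m, zmodToQmodZ m k = (Multiplicative.toAdd (g' σ)).down := fun σ => by
    obtain ⟨c, rfl⟩ := hsurj' σ
    rw [hg', hf]
    exact hval c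
  choose k hk using hgval
  have hkadd : ∀ σ τ, k (σ * τ) = k σ + k τ := fun σ τ => by
    apply zmodToQmodZ_injective m
    rw [map_add, hk, hk, hk, map_mul, toAdd_mul]
    rfl
  let χ : Additive (L' ≃ₐ[K] L') →+ ZMod m :=
    AddMonoidHom.mk' (fun a => k (Additive.toMul a)) fun a b => hkadd (Additive.toMul a) (Additive.toMul b)
  refine ⟨L', hL'fd, hL'ab, hL'unr, χ, fun h0 => hχ₀x ?_⟩
  -- `χ(ψ_{L'} x) = 0` forces `χ₀(θ x̄) = 0`
  change k (artinIdeleMap L' artinReciprocity_character_holds x) = 0 at h0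
  have h1 := hk (artinIdeleMap L' artinReciprocity_character_holds x)
  rw [h0, map_zero, ← artinClassMap_mk L' artinReciprocity_character_holds x,
    ← artinMapFamily_eq artinReciprocity_character_holds L', hg', hf, toAdd_ofAdd] at h1
  exact ULift.ext _ _ h1.symm

/-! ## §5. The equivalence, and its Bockstein form -/

/-- **`x̄ ∈ C_Kᵐ · Ū_K^S ⟺ χ(ψ_{L|K} x) = 0` for every finite abelian `L ⊆ K̄` unramified outside `S` and every
`χ : Gal(L/K) → ℤ/m`** (`m ≥ 1`) — Harari's Prop. 15.42 (a) (`C_S(K) / D_S(K) ≅ G_{K,S}^{ab}`, `D_S(K)` divisible) read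
modulo `m`: the injectivity of Milne's `α¹(G_{K,S}, ℤ/m) : C_S(K)/m → Hom(H¹(G_{K,S}, ℤ/m), ℚ/ℤ)` for the `S`-idèle class
formation `(G_{K,S}, C_S)`, on the finite layers.
[cite: Harari2020, Prop. 15.42 (a), Thm. 17.2] [cite: LangANT1994, Ch. XI §4 Thm. 4] [cite: MilneADT2006, Ch. I Thm. 1.8 (b)] -/
theorem mk_mem_pow_sup_unitIdelesOutside_iff_forall_unramified_character {m : ℕ} (hm : 0 < m)
    (S : Finset (HeightOneSpectrum (𝓞 K))) (x : ideleGroup K) :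
    (QuotientGroup.mk x : ideleGroup K ⧸ principalIdeles K) ∈
        (@powMonoidHom (ideleGroup K ⧸ principalIdeles K) _ m).range ⊔
          (unitIdelesOutside K S).map (QuotientGroup.mk' (principalIdeles K)) ↔
      ∀ (L : IntermediateField K (AlgebraicClosure K)) (_ : FiniteDimensional K L) (_ : IsAbelianGalois K L),
        (∀ v : HeightOneSpectrum (𝓞 K), v ∉ S →
          Algebra.IsUnramifiedIn (𝓞 (L : IntermediateField K (AlgebraicClosure K))) v.asIdeal) →
        ∀ χ : Additive (L ≃ₐ[K] L) →+ ZMod m,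
          haveI : NumberField L := NumberField.of_module_finite K L
          χ (Additive.ofMul (artinIdeleMap L artinReciprocity_character_holds x)) = 0 := by
  constructor
  · intro hx L hL hab hunr χ
    haveI := hL
    haveI := hab
    haveI : NumberField L := NumberField.of_module_finite K L
    exact character_artinIdeleMap_eq_zero_of_mem_pow_sup_unitIdelesOutside L hunr hx χ
  · intro h
    by_contra hx
    obtain ⟨L, hL, hab, hunr, χ, hχ⟩ :=
      exists_unramified_layer_character_ne_zero_of_not_mem_pow_sup_unitIdelesOutside hm S hx
    exact hχ (h L hL hab hunr χ)

open CategoryTheory groupCohomology Literature.Algebra.Homology Literature.Algebra.Homology.Bockstein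
  Literature.NumberTheory.Automorphic Literature.NumberTheory.Automorphic.IdeleClassGroup IdeleCohomology in
/-- **Bockstein form** (the layer pairing of Milne's `α¹` for `(G_{K,S}, C_S)`): for `m ≥ 1` and an idèle `x` of `K`,
`inv_{L/K}(ι[x] ∪ β_m[χ]) = 0` for every finite abelian `L ⊆ K̄` unramified outside `S` and every `χ : Gal(L/K) → ℤ/m`
iff `x̄ ∈ C_Kᵐ · Ū_K^S` (door-c6 g14's `inv_{L/K}(ι[x] ∪ β_m[χ]) = −χ(ψ_{L|K} x)/m`).
[cite: MilneADT2006, Ch. I Thm. 1.8 (b), §4] [cite: Harari2020, Prop. 15.42 (a), Thm. 17.2]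
[cite: CasselsFrohlichANT1967, Ch. VII §11.3] -/
theorem forall_unramified_layer_pairing_eq_zero_iff_mk_mem_pow_sup_unitIdelesOutside {m : ℕ} (hm : 0 < m)
    (S : Finset (HeightOneSpectrum (𝓞 K))) (x : ideleGroup K) :
    haveI : NeZero m := ⟨hm.ne'⟩
    (∀ (L : IntermediateField K (AlgebraicClosure K)) (_ : FiniteDimensional K L) (_ : IsAbelianGalois K L),
        (∀ v : HeightOneSpectrum (𝓞 K), v ∉ S →
          Algebra.IsUnramifiedIn (𝓞 (L : IntermediateField K (AlgebraicClosure K))) v.asIdeal) →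
        ∀ χ : Additive (L ≃ₐ[K] L) →+ ZMod m,
        haveI : NumberField L := NumberField.of_module_finite K L
        classInvAll K L (baseCup (E := L) x
          (δ (intModShortComplex_shortExact (L ≃ₐ[K] L) m) 1 2 rfl
            ((H1IsoOfIsTrivial (Rep.trivial ℤ (L ≃ₐ[K] L) (ZMod m))).inv χ))) = 0) ↔
      (QuotientGroup.mk x : ideleGroup K ⧸ principalIdeles K) ∈
        (@powMonoidHom (ideleGroup K ⧸ principalIdeles K) _ m).range ⊔
          (unitIdelesOutside K S).map (QuotientGroup.mk' (principalIdeles K)) := by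
  haveI : NeZero m := ⟨hm.ne'⟩
  rw [mk_mem_pow_sup_unitIdelesOutside_iff_forall_unramified_character hm S x]
  refine forall_congr' fun L => forall_congr' fun hL => forall_congr' fun hab => forall_congr' fun _ =>
    forall_congr' fun χ => ?_
  haveI := hL
  haveI := hab
  haveI : NumberField L := NumberField.of_module_finite K L
  exact classInvAll_baseCup_bockstein_eq_zero_iff_artinIdeleMap L m χ x

end Literature.NumberTheory.GaloisRepresentations

end
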